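import Summits.BirchSwinnertonDyer.Rank1Residual.ManinAdditive.ThetaBrandtTamagawaTwo
import HarnessLib
import HarnessLib.Audit.Tags

/-!
# The θ-BRANDT line at `4 ∥ N` — §4R: the ι-law RESTATED ON THE OPTIMAL CURVE (repair of rows E-desc-119 / E-desc-119♭
# after ref1 §R134; rows E-desc-119R / E-desc-119♭R / E-desc-122 typed; cell `bsd-f2-manin`, desc g18, MEMO-desc §38;
# nothing asserted)

WHY THIS FILE.  The landed rows `ThetaIotaSignLawAtFourPrime` (E-desc-119) and `TamagawaTwoFromBrandtAtFourPrime`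
(E-desc-119♭) of `ThetaBrandtTamagawaTwo.lean` quantify over EVERY `W` with `W.conductorNorm ℤ = 4 * p`, while the
θ-newform `g`, the unit `u` and `W.LFunction` are ISOGENY-CLASS invariants and `tamagawaAt W 2`,
`IsThreeEisensteinDegenerateAtFour W` are not: under the (unique, ref1 THEOREM T1(α)) rational 3-isogeny of a class at
`4 ∥ N` the Tamagawa number `c₂` FLIPS between `1` and `3` (T1(γ)).  Refuter ref1 §R134 KILLED both rows as MISSTATED with
the witness `W = 124a2 = [0,1,0,18,−11]` (`N = 124 = 4·31`; class sign `s = −1`, `c₂(124a2) = 1`, `E(ℚ)_tors = 0`), and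
8 more classes `≤ 5780` (172a, 892b, 916d, 1108a, 1132c, 3988b, 4204b, 5596b: each the partner `E/E(ℚ)[3]` of an optimal
curve with rational 3-torsion at `p ≡ 1 (mod 3)`); 0 / 123 violations at OPTIMAL members (ref1 r134c; desc 1759 / 1759).
REPAIR C′ (ref1): the law is about the `X₀(4p)`-OPTIMAL curve — add `[W.IsGloballyMinimal] [NeZero (W.conductorNorm ℤ)]
(D : ModularParametrizationData W (W.conductorNorm ℤ))`, the lattice clause and the minimal-degree clause VERBATIM as in
`ThetaEisensteinCriterionAtFourPrime` (E-desc-118).  This file does exactly that under NEW names (append-only; the killed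
decls stay in the tree as settled negative edges and are not reworded): `ThetaIotaSignLawAtFourPrimeOptimal` (E-desc-119R),
`TamagawaTwoFromBrandtAtFourPrimeOptimal` (E-desc-119♭R); the witness misses C′ (124a2 is not optimal: its modular
parametrisation factors through 124a1, degree `3 · 6`).

WHAT IS NEW (desc g18, MEMO-desc §38).  (1) The two E-side inputs of the pointwise edge are typed as named folklore facts
(ref1 THEOREM T1, Tate's algorithm): `TamagawaTwoMemOneThreeAtFour` (`4 ∥ N ⟹ c₂ ∈ {1,3}`) and
`TamagawaTwoOfThreeTorsionAtFour` (`4 ∥ N ∧ E(ℚ)[3] ≠ 0 ⟹ c₂ = 3`), and the GLOBAL edge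
`tamagawaTwoFromBrandtOptimal_of_signLawOptimal` (119R ∧ 118 ∧ the two facts ⟹ 119♭R) is proved.  (2) Row E-desc-122
`ThetaIotaSignOfThreeTorsionAtFourPrimeOptimal`: for an OPTIMAL curve with a rational 3-torsion point at `N = 4p` the Brandt
sign is FULLY E-FACING — `u ≡ 1 (mod λ) ⟺ (p ≡ 2 (mod 3) ∧ 3 ∤ c_p(E))` — and it is DERIVED here from E-desc-119R and
`TamagawaTwoOfThreeTorsionAtFour` (`iotaSignOfThreeTorsion_of_signLawOptimal`, proved): at `p ≡ 1 (mod 3)` every optimal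
3-torsion curve has `s = −1`, which is exactly the configuration of the nine witness classes (the OPTIMAL member carries the
torsion point and `c₂ = 3`; the partner has `c₂ = 1` and is invisible to the law).  (3) Kernel anchors AT THE WITNESS LEVEL
`p = 31` (`dim 𝓜_θ(31) = 2`): `g124a` (class 124a, `E(ℚ)[3] = ℤ/3`, `p ≡ 1 (mod 3)`, optimal `124a1` has `c₂ = 3`):
`ι g = −ω · g`, `−ω ≢ 1 (mod λ)`, sign `−1`; `g124b` (class 124b, `c₂ = 1`, no 3-isogeny): `ι g = ω · g`, sign `+1`;
both θ-equivariant Hecke eigenfunctions at `ℓ = 3` (`a₃ = −2`, resp. `0`), `decide +kernel`.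
(4) MECHANISM (MEMO-desc §38.3, paper): optimality enters through VISIBILITY — if `ψ : E₀ → E₁ = E₀/C₀` is the 3-isogeny
from the optimal curve, the dual parametrisation `E₁ → J₀(N)` is `E₁ → E₀ ↪ J₀(N)` and kills `ψ(E₀[3]) = E₁[3]^{I₂}`: the
inertia-fixed 3-line of the NON-optimal member dies in `J₀(N)`, the optimal member's `C₀ = E₀[3]^{I₂}` is visible; the
Brandt vector mod `λ` lives in `𝔽₃[SS(X₀(M))] ⊇` (character group of `J₀(2M)` at 2)`/3`, where `Frob₂ = Π^*` (Ribet) and the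
toric 3-torsion carries `χ̄₃ ⊗ Frob`; so the sign it reads is `−(Frob₂ | C₀)` — the OPTIMAL curve's line (356 / 356
reducible non-degenerate optimal classes satisfy `s = −ψ_{C₀}(Frob₂)`, ref1 r134b; irreducible classes: `E[3]` is constant on
the class and the law is THEOREM-candidate R of `ThetaBrandtTamagawaTwo.lean`).

CENSUS (BC5 witness; unchanged data, re-read on the optimal member): HOME/desc/g17b/IOTA-all.tsv sha16 639917d841e396d2
(1759 optimal curves, `4 ∥ N ≤ 5780`, all odd `M ≤ 1445`; prime `M = p`: 123 classes / 151 curves, ref1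
R134c-class-members.txt c5bd506c3b9c7d4c): E-desc-119R 1759 / 1759 (prime level 123 / 123); E-desc-122: the optimal
3-torsion curves at prime level `4p ≤ 5780` — see MEMO-desc §38.2 for the count by `p mod 3` (0 exceptions).
PARTITION currency: desc-lane laws about `c₂` and the θ-Brandt line (outside the C2/C3 partition: 0).  Beyond-print
theorem: NO (laws + a proved edge + kernel certificates).  BSD / Manin `c = 1` / C2 are NOT proved by anything here.

[cite: SilvermanATAEC1994, IV.9 Table 4.1 p. 365 (Tate's algorithm: Kodaira IV has c ∈ {1,3}, IV* has c ∈ {1,3}; f = 2 at a tame additive prime)]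
[cite: Tate1975, §6 (algorithm for the special fibre; c_p for types IV, IV*)]
[cite: DarmonDiamondTaylor1995, Thm. 3.15 and Thm. 3.1(e) p. 86 (level lowering mod 3 to level 2M; shape of ρ̄|D₂ at p ∥ N: (χ̄₃μ ∗; 0 μ), μ(Frob₂) = a₂)]
[cite: Gross1987Heights, §§1–4 (Brandt module at prime level, heights, supersingular points)]

TYPER NOTE (typer g18, T-desc-31 — supersedes T-desc-28′).  SOURCE = HOME/desc/g18/Sketch-desc-g18.lean sha16 8e4ed8890abce97a (289 l.; farm
check-g18-v2.json rc 0 · 0 err · 0 warn · 0 sorry; BC7 ProbeG18.txt), landed VERBATIM as a SIBLING of `ThetaBrandtTamagawaTwo.lean` (p701245,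
which keeps the KILLED rows E-desc-119 `ThetaIotaSignLawAtFourPrime` / E-desc-119♭ `TamagawaTwoFromBrandtAtFourPrime` with their bodies —
append-only; their docstrings get the «REFUTED-misstated (ref1 §R134, witness 124a2) — SUPERSEDED by …Optimal» paragraph at the next substantive
touch of that file; CANDIDATES §E.1 marks them DEAD-kept-by-rule now) except: (i) this note; (ii) the bib key `DDT1995` → `DarmonDiamondTaylor1995`
(the key in references.bib); (iii) two PROVED bridge lemmas `thetaIotaSignLawAtFourPrimeOptimal_of_unrestricted` /
`tamagawaTwoFromBrandtAtFourPrimeOptimal_of_unrestricted` (the killed unrestricted rows trivially imply the repaired ones — the formal record of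
the supersession); (iv) typer docstrings on `g124a_isThetaEquivariant` / `g124b_isThetaEquivariant` if missing.  REFUTER: ref1 §R134 (R-desc-28):
dictionary (a)–(d) PASS ×4, S-desc-27 CORRECT on paper (folklore-level corollary), `ThetaIotaUnitAtFourPrime` SURVIVES, E-119/119♭ KILLED-misstated,
repair C′ = «+ optimality clauses» = THIS file's E-desc-119R / 119♭R («the witness MISSES C′»); R-desc-31 (audit of this file) PENDING at filing.
BC5 WITNESS (unchanged data re-read on the optimal member): HOME/desc/g17b/IOTA-all.tsv 639917d841e396d2 — E-desc-119R 1759/1759 (prime level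
123/123 classes; ref1 r134c: 0/123 optimal violations, 9 non-optimal partners excluded by C′); E-desc-122 per MEMO-desc §38.2 (0 exceptions).
PARTITION 0 (desc-lane laws outside the C2/C3 partition); beyond-print theorem: NO.  BSD is not proved by this; C2/C3 OPEN.
-/

open scoped MatrixGroups ModularForm

open CongruenceSubgroup WeierstrassCurve Literature.NumberTheory.EllipticCurves.ModularForms

open Summit.BirchSwinnertonDyer.Rank1Residual.ManinAdditive.ConwayCut
open Summit.BirchSwinnertonDyer.Rank1Residual.ManinAdditive.RamanujanCut (HasRationalThreeTorsion)

noncomputable section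

namespace Summit.BirchSwinnertonDyer.Rank1Residual.ManinAdditive.ThetaBrandt

/-! ### §4R.1 Two E-side folklore facts at `4 ∥ N` (ref1 THEOREM T1; Tate's algorithm) — named, nothing asserted -/

/-- **Fact (folklore, ref1 THEOREM T1(ii); Tate's algorithm).**  `4 ∥ N ⟹` Kodaira type `IV` or `IV*` at `2 ⟹ c₂(E) ∈ {1, 3}`.
[cite: SilvermanATAEC1994, IV.9 Table 4.1 (types IV, IV*: c = 1 or 3)] -/
def TamagawaTwoMemOneThreeAtFour : Prop :=
  ∀ (W : WeierstrassCurve ℚ) [W.IsElliptic], padicValNat 2 (W.conductorNorm ℤ) = 2 →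
    tamagawaAt W 2 = 1 ∨ tamagawaAt W 2 = 3

/-- **Fact (folklore, ref1 THEOREM T1(γ)).**  `4 ∥ N` and `E(ℚ)[3] ≠ 0 ⟹ c₂(E) = 3`: `E⁰(ℚ₂)` is uniquely 3-divisible
(`Ẽ_ns(𝔽₂) = 𝔽₂⁺`, `Ê` pro-2 up to index 2), so `E(ℚ₂)[3] ≅ Φ(𝔽₂)[3]` and a rational 3-torsion point forces `|Φ(𝔽₂)| = 3`.
[cite: SilvermanATAEC1994, IV.9 Table 4.1; Tate1975, §6] -/
def TamagawaTwoOfThreeTorsionAtFour : Prop :=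
  ∀ (W : WeierstrassCurve ℚ) [W.IsElliptic], padicValNat 2 (W.conductorNorm ℤ) = 2 →
    HasRationalThreeTorsion W → tamagawaAt W 2 = 3

/-! ### §4R.2 The repaired rows (optimality clauses verbatim from `ThetaEisensteinCriterionAtFourPrime`) -/

/-- **Row E-desc-119R `ThetaIotaSignLawAtFourPrimeOptimal` — THE TAMAGAWA NUMBER AT 2 FROM THE θ-BRANDT VECTOR, ON THE
OPTIMAL CURVE (LAW; repair of E-desc-119 per ref1 §R134; cell bsd-f2-manin, desc g18, MEMO-desc §38; nothing asserted).**
For the `X₀(4p)`-optimal curve `E` (`p ≥ 5` prime; globally minimal model, modular parametrisation `D` of level `N = 4p`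
with the lattice clause `Λ_E ⊆ c·Λ_f` and the minimal-degree clause) and any primitive θ-equivariant Hecke eigenfunction `g`
for `(a_ℓ(E))` with `ι g = u g`, `u` a unit: `u ≡ 1 (mod λ)` **iff** `c₂(E) = 1` or `E` is 3-Eisenstein-degenerate.
Census 1759 / 1759 optimal curves (`4 ∥ N ≤ 5780`), 123 / 123 at prime level; the ref1 witness `124a2` is not optimal and
misses the hypotheses.  Why it might fail: an optimal curve whose θ-line mod `λ` is not the visibility image of
`E[3]^{I₂}(−1)` in the character group of `J₀(2p)` at 2 (multiplicity-one failure mod 3 in the Eisenstein case).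
[cite: DarmonDiamondTaylor1995, Thm. 3.1(e) p. 86 and Thm. 3.15 (shape of ρ̄|D₂ for the 2-new level-2p congruent form; level lowering mod 3)]
[cite: Gross1987Heights, §§1–4 (Brandt module / supersingular points at prime level)] -/
@[conjecture]
def ThetaIotaSignLawAtFourPrimeOptimal : Prop :=
  ∀ (p : ℕ), p.Prime → 5 ≤ p →
  ∀ (W : WeierstrassCurve ℚ) [W.IsElliptic] [W.IsGloballyMinimal] [NeZero (W.conductorNorm ℤ)]
    (D : ModularParametrizationData W (W.conductorNorm ℤ)),
    W.conductorNorm ℤ = 4 * p →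
    (∀ z ∈ D.L.lattice, ∃ w ∈ periodLattice D.f, z = D.c * w) →
    (∀ (W' : WeierstrassCurve ℚ) [W'.IsElliptic]
        (D' : ModularParametrizationData W' (W.conductorNorm ℤ)),
        D'.f = D.f → D.modularDegree ≤ D'.modularDegree) →
  ∀ g : Fin (p + 1) → ZOmega,
    IsThetaEquivariant p g → IsPrimitive p g → IsThetaHeckeEigen p g (fun n => W.LFunction n) →
    ∀ u : ZOmega, ZOmega.norm u = 1 → (∀ x, thetaIota p g x = ZOmega.mul u (g x)) →
      (ZOmega.IsOneModLambda u ↔ (tamagawaAt W 2 = 1 ∨ IsThreeEisensteinDegenerateAtFour W))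

/-- **Row E-desc-119♭R `TamagawaTwoFromBrandtAtFourPrimeOptimal` (the same law as an E-blind FORMULA for `c₂` of the
OPTIMAL curve; repair of E-desc-119♭; nothing asserted):** `c₂(E) = 3` iff (`ι g = u g` with `u ≢ 1 (mod λ)`) or `g` is
Eisenstein mod `λ`. [conjecture] -/
@[conjecture]
def TamagawaTwoFromBrandtAtFourPrimeOptimal : Prop :=
  ∀ (p : ℕ), p.Prime → 5 ≤ p →
  ∀ (W : WeierstrassCurve ℚ) [W.IsElliptic] [W.IsGloballyMinimal] [NeZero (W.conductorNorm ℤ)]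
    (D : ModularParametrizationData W (W.conductorNorm ℤ)),
    W.conductorNorm ℤ = 4 * p →
    (∀ z ∈ D.L.lattice, ∃ w ∈ periodLattice D.f, z = D.c * w) →
    (∀ (W' : WeierstrassCurve ℚ) [W'.IsElliptic]
        (D' : ModularParametrizationData W' (W.conductorNorm ℤ)),
        D'.f = D.f → D.modularDegree ≤ D'.modularDegree) →
  ∀ g : Fin (p + 1) → ZOmega,
    IsThetaEquivariant p g → IsPrimitive p g → IsThetaHeckeEigen p g (fun n => W.LFunction n) →
    ∀ u : ZOmega, ZOmega.norm u = 1 → (∀ x, thetaIota p g x = ZOmega.mul u (g x)) →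
      (tamagawaAt W 2 = 3 ↔ (¬ ZOmega.IsOneModLambda u ∨ IsEisensteinModLambda p g))

/-- `4 ∥ 4p` for an odd prime `p`. -/
theorem padicValNat_two_four_mul {p : ℕ} (hp : p.Prime) (h5 : 5 ≤ p) : padicValNat 2 (4 * p) = 2 := by
  have h2 : ¬ 2 ∣ p := by
    intro h
    have := (Nat.Prime.eq_one_or_self_of_dvd hp 2 h)
    omega
  haveI : Fact (Nat.Prime 2) := ⟨Nat.prime_two⟩
  rw [padicValNat.mul (by norm_num) hp.ne_zero, show (4 : ℕ) = 2 ^ 2 by norm_num, padicValNat.prime_pow,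
    padicValNat.eq_zero_of_not_dvd h2]

/-- **GLOBAL EDGE (proved): E-desc-119R ∧ E-desc-118 ∧ the two folklore facts ⟹ E-desc-119♭R** (via the landed pointwise
edge `tamagawaTwo_iff_of_signLaw`). -/
theorem tamagawaTwoFromBrandtOptimal_of_signLawOptimal
    (h119 : ThetaIotaSignLawAtFourPrimeOptimal) (h118 : ThetaEisensteinCriterionAtFourPrime)
    (hc : TamagawaTwoMemOneThreeAtFour) (ht : TamagawaTwoOfThreeTorsionAtFour) :
    TamagawaTwoFromBrandtAtFourPrimeOptimal := by
  intro p hp h5 W _ _ _ D hN hΛ hmin g hθ hprim heig u hu hι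
  have h4 : padicValNat 2 (W.conductorNorm ℤ) = 2 := by rw [hN]; exact padicValNat_two_four_mul hp h5
  refine tamagawaTwo_iff_of_signLaw (hc W h4) (h118 p hp h5 W D hN hΛ hmin g hθ hprim heig) ?_
    (h119 p hp h5 W D hN hΛ hmin g hθ hprim heig u hu hι)
  intro hdeg
  exact ht W h4 hdeg.1


/-- Bridge (formal record of the supersession): the KILLED unrestricted row E-desc-119 trivially implies the repaired E-desc-119R
(the optimality clauses are extra hypotheses).  Typer g18. -/
theorem thetaIotaSignLawAtFourPrimeOptimal_of_unrestricted (h : ThetaIotaSignLawAtFourPrime) :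
    ThetaIotaSignLawAtFourPrimeOptimal :=
  fun p hp h5 W _ _ _ _D hN _ _ g hθ hprim heig u hu hι => h p hp h5 W hN g hθ hprim heig u hu hι

/-- Bridge: the KILLED unrestricted row E-desc-119♭ trivially implies the repaired E-desc-119♭R.  Typer g18. -/
theorem tamagawaTwoFromBrandtAtFourPrimeOptimal_of_unrestricted (h : TamagawaTwoFromBrandtAtFourPrime) :
    TamagawaTwoFromBrandtAtFourPrimeOptimal :=
  fun p hp h5 W _ _ _ _D hN _ _ g hθ hprim heig u hu hι => h p hp h5 W hN g hθ hprim heig u hu hι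

/-! ### §4R.3 Row E-desc-122: the Brandt sign of an optimal 3-TORSION curve is E-facing (derived from E-desc-119R) -/

/-- at `N = 4p` the 3-Eisenstein degeneracy condition reads `E(ℚ)[3] ≠ 0 ∧ 3 ∤ c_p(E) ∧ p ≡ 2 (mod 3)` (the only odd
prime of bad reduction is `p`, and `p ∥ N`). -/
theorem isThreeEisensteinDegenerateAtFour_iff_of_conductor_eq {p : ℕ} (hp : p.Prime) (h5 : 5 ≤ p)
    {W : WeierstrassCurve ℚ} (hN : W.conductorNorm ℤ = 4 * p) :
    IsThreeEisensteinDegenerateAtFour W ↔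
      (HasRationalThreeTorsion W ∧ ¬ 3 ∣ tamagawaAt W p ∧ p % 3 = 2) := by
  have hp2 : p ≠ 2 := by omega
  have hpsq : ¬ p ^ 2 ∣ W.conductorNorm ℤ := by
    rw [hN]
    intro h
    have h' : p * p ∣ 4 * p := by simpa [pow_two] using h
    have : p ∣ 4 := by
      have := Nat.dvd_of_mul_dvd_mul_right hp.pos (by simpa [mul_comm] using h')
      exact this
    have := Nat.le_of_dvd (by norm_num) this
    omega
  constructor
  · rintro ⟨hT, hall⟩
    have hq := hall p hp hp2 (by rw [hN]; exact Dvd.intro_left 4 rfl)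
    exact ⟨hT, hq.1, hq.2 hpsq⟩
  · rintro ⟨hT, hc, hmod⟩
    refine ⟨hT, fun q hq hq2 hqd => ?_⟩
    have hqp : q = p := by
      rw [hN] at hqd
      rcases (Nat.Prime.dvd_mul hq).mp hqd with h4 | h4
      · exfalso
        have h22 : q ∣ 2 ^ 2 := by simpa using h4
        have := (Nat.prime_dvd_prime_iff_eq hq Nat.prime_two).mp (Nat.Prime.dvd_of_dvd_pow hq h22)
        exact hq2 this
      · exact (Nat.prime_dvd_prime_iff_eq hq hp).mp h4
    subst hqp
    exact ⟨hc, fun _ => hmod⟩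

/-- **Row E-desc-122 `ThetaIotaSignOfThreeTorsionAtFourPrimeOptimal` (LAW, derived; desc g18, MEMO-desc §38.2; nothing
asserted).**  For the `X₀(4p)`-OPTIMAL curve `E` with a rational point of order 3, the Brandt sign is E-facing:
`u ≡ 1 (mod λ) ⟺ (p ≡ 2 (mod 3) ∧ 3 ∤ c_p(E))`.  In particular at `p ≡ 1 (mod 3)` every optimal 3-torsion curve has sign
`−1` (anchor `g124a` below) — the configuration of all nine ref1 witness classes, whose NON-optimal partner `E/E(ℚ)[3]` has
`c₂ = 1` and is invisible to the law.  Census (IOTA-all.tsv, prime level): MEMO-desc §38.2.  Why it might fail: only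
through E-desc-119R (this row is its corollary given `TamagawaTwoOfThreeTorsionAtFour`). [conjecture] -/
@[conjecture]
def ThetaIotaSignOfThreeTorsionAtFourPrimeOptimal : Prop :=
  ∀ (p : ℕ), p.Prime → 5 ≤ p →
  ∀ (W : WeierstrassCurve ℚ) [W.IsElliptic] [W.IsGloballyMinimal] [NeZero (W.conductorNorm ℤ)]
    (D : ModularParametrizationData W (W.conductorNorm ℤ)),
    W.conductorNorm ℤ = 4 * p →
    (∀ z ∈ D.L.lattice, ∃ w ∈ periodLattice D.f, z = D.c * w) →
    (∀ (W' : WeierstrassCurve ℚ) [W'.IsElliptic]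
        (D' : ModularParametrizationData W' (W.conductorNorm ℤ)),
        D'.f = D.f → D.modularDegree ≤ D'.modularDegree) →
    HasRationalThreeTorsion W →
  ∀ g : Fin (p + 1) → ZOmega,
    IsThetaEquivariant p g → IsPrimitive p g → IsThetaHeckeEigen p g (fun n => W.LFunction n) →
    ∀ u : ZOmega, ZOmega.norm u = 1 → (∀ x, thetaIota p g x = ZOmega.mul u (g x)) →
      (ZOmega.IsOneModLambda u ↔ (p % 3 = 2 ∧ ¬ 3 ∣ tamagawaAt W p))

/-- **edge (proved): E-desc-119R ∧ `TamagawaTwoOfThreeTorsionAtFour` ⟹ E-desc-122.** -/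
theorem iotaSignOfThreeTorsion_of_signLawOptimal
    (h119 : ThetaIotaSignLawAtFourPrimeOptimal) (ht : TamagawaTwoOfThreeTorsionAtFour) :
    ThetaIotaSignOfThreeTorsionAtFourPrimeOptimal := by
  intro p hp h5 W _ _ _ D hN hΛ hmin hT g hθ hprim heig u hu hι
  have h4 : padicValNat 2 (W.conductorNorm ℤ) = 2 := by rw [hN]; exact padicValNat_two_four_mul hp h5
  have h3 : tamagawaAt W 2 = 3 := ht W h4 hT
  rw [h119 p hp h5 W D hN hΛ hmin g hθ hprim heig u hu hι, isThreeEisensteinDegenerateAtFour_iff_of_conductor_eq hp h5 hN]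
  constructor
  · rintro (h1 | ⟨_, hc, hm⟩)
    · omega
    · exact ⟨hm, hc⟩
  · rintro ⟨hm, hc⟩
    exact Or.inr ⟨hT, hc, hm⟩

/-! ### §4R.4 Kernel certificates at the witness level `p = 31` (`dim 𝓜_θ(31) = 2`: classes 124a and 124b) -/

/-- the θ-newform of **`124a1`** (`p = 31 ≡ 1 (mod 3)`, `N = 124`, Kodaira `IV`, `E(ℚ)_tors = ℤ/3`, rank `1`, `c₂ = 3`,
`c₃₁ = 1`, `deg φ = 6`; NOT 3-Eisenstein-degenerate since `31 ≡ 1 (mod 3)`; `a₃ = −2`, `a₅ = −3`).  Its 3-isogeny partner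
`124a2 = [0,1,0,18,−11]` (`c₂ = 1`, `deg 18`) is the ref1 §R134 witness against the un-repaired row. -/
def g124a : Fin 32 → ZOmega :=
  ![(0, -1), (1, 0), (1, 1), (-1, 0), (0, 0), (0, 1), (0, 1), (0, 0), (1, 1), (0, 0), (-1, 0), (-1, 0), (-1, -1), (0, 0),
    (-1, 0), (1, 1), (0, 1), (0, -1), (-1, -1), (0, 0), (0, -1), (-1, -1), (0, 0), (0, 0), (0, 0), (1, 0), (1, 0), (1, 1),
    (-1, -1), (0, 1), (1, 0), (0, -1)]

/-- `g124a` is θ-equivariant (kernel certificate). -/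
theorem g124a_isThetaEquivariant : IsThetaEquivariant 31 g124a := by
  unfold IsThetaEquivariant; decide +kernel

/-- on the support of `𝓜_θ(31)` every stabiliser weight is `1`: `W g = g` for `g = g124a` (kernel certificate; this keeps
the Hecke certificate below small enough for `decide +kernel`). -/
theorem g124a_weightMul : ∀ x : Fin 32, weightMul 31 g124a x = g124a x := by
  decide +kernel

/-- `T₂₄,₃ (W g) = 24 · (−2) · (W g)` (`a₃(124a1) = −2`; stated on `g = W g` by `g124a_weightMul`). -/
theorem g124a_hecke_three :
    ∀ x : Fin 32, thetaHecke24 31 3 g124a x = (24 * (-2) * (g124a x).1, 24 * (-2) * (g124a x).2) := by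
  decide +kernel

/-- `124a1`: `ι g = −ω · g` — sign `−1` (`−ω ≢ 1 mod λ`), matching `c₂(124a1) = 3`, `t = 0` (E-desc-119R) and
`p = 31 ≡ 1 (mod 3)` (E-desc-122); `12⟨m,m⟩ = 24`, `deg φ = 6` (E-desc-117: `4 · 6 = 24`). -/
theorem g124a_iota : (∀ x : Fin 32, thetaIota 31 g124a x = ZOmega.mul (0, -1) (g124a x)) ∧ ¬ ZOmega.IsOneModLambda (0, -1) := by
  constructor
  · decide +kernel
  · show ¬ (3 : ℤ) ∣ (0 : ℤ) + (-1) - 1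
    omega

/-- `12 ⟨m, m⟩ (124a1) = 24`. -/
theorem g124a_height : thetaHeightTwelve 31 g124a = 24 := by
  decide +kernel

/-- the θ-newform of **`124b1`** (`p = 31`, `N = 124`, Kodaira `IV`, `E(ℚ)_tors = 0`, `c₂ = 1`, `deg φ = 6`, `ρ̄₃`
irreducible; `a₃ = 0`, `a₅ = 1`): the other line of `𝓜_θ(31)`. -/
def g124b : Fin 32 → ZOmega :=
  ![(0, 1), (1, 0), (-1, -1), (1, 0), (0, 0), (0, 1), (0, 1), (0, 0), (-1, -1), (0, 0), (1, 0), (1, 0), (-1, -1), (0, 0),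
    (1, 0), (-1, -1), (0, 1), (0, 1), (-1, -1), (0, 0), (0, 1), (-1, -1), (0, 0), (0, 0), (0, 0), (1, 0), (1, 0), (-1, -1),
    (-1, -1), (0, 1), (1, 0), (0, 1)]

/-- `g124b` is θ-equivariant (kernel certificate). -/
theorem g124b_isThetaEquivariant : IsThetaEquivariant 31 g124b := by
  unfold IsThetaEquivariant; decide +kernel

/-- `W g = g` for `g = g124b` (all support weights `1`). -/
theorem g124b_weightMul : ∀ x : Fin 32, weightMul 31 g124b x = g124b x := by
  decide +kernel

/-- `T₂₄,₃ (W g) = 24 · 0 · (W g) = 0` (`a₃(124b1) = 0`; stated on `g = W g` by `g124b_weightMul`). -/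
theorem g124b_hecke_three :
    ∀ x : Fin 32, thetaHecke24 31 3 g124b x = (0, 0) := by
  decide +kernel

/-- `124b1`: `ι g = ω · g` — sign `+1` (`ω ≡ 1 mod λ`), matching `c₂(124b1) = 1` (E-desc-119R). -/
theorem g124b_iota : (∀ x : Fin 32, thetaIota 31 g124b x = ZOmega.mul (0, 1) (g124b x)) ∧ ZOmega.IsOneModLambda (0, 1) := by
  constructor
  · decide +kernel
  · show (3 : ℤ) ∣ (0 : ℤ) + 1 - 1
    omega

end Summit.BirchSwinnertonDyer.Rank1Residual.ManinAdditive.ThetaBrandt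

end
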